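import Mathlib.Analysis.Calculus.MeanValue
import Mathlib.Analysis.Calculus.ContDiff.Basic
import Mathlib.Analysis.Calculus.ContDiff.RCLike
import Mathlib.Analysis.InnerProductSpace.Basic
import Mathlib.Analysis.Normed.Module.FiniteDimension
import Mathlib.Topology.MetricSpace.ProperSpace
import HarnessLib

/-!
# First reading of a PD map near a simplex: the pointwise stage conditions at small scale

Topic `Literature/Topology/FourManifolds`; Euclidean analysis in `E × F` (codimension `≥ 2` step of
the smoothing of PD homeomorphisms: Munkres, Ann. of Math. 72 (1960), §§4–5; Campbell–D'Onofrio–Vítek,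
J. Geom. Anal. (2026), §3).  In coordinates adapted to an open simplex `σ° = V × {0}` the smooth model
`u = (T, N) : E × F → E × F` of the PD map on a closed sector satisfies `T (x, 0) = x`,
`N (x, 0) = 0` (`σ` is fixed pointwise) and has invertible fibre derivative `D_yN(x, 0)`.  From
uniform `C²` bounds on a compact `K × B̄(0, r₀)` we derive the **scale-`t` estimates** that feed
the pointwise hypotheses of the tube stage (`TubeStageDiffeo.exists_hasFDerivAt_equiv_tubeStageMap`)
at the first reading, `t = ‖y‖`:

* `exists_fderiv_lipschitz_snd`: `‖Du(x,y) − Du(x,y')‖ ≤ L ‖y − y'‖` (mean value on the `C¹` map `Du`);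
* `norm_taylor_snd_le`: `‖u(x,y) − u(x,0) − Du(x,0)(0,y)‖ ≤ L t²`;
* `norm_euler_defect_snd_le`: `‖Du(x,y)(0,y) − (u(x,y) − u(x,0))‖ ≤ 2L t²` — the (target-form)
  **Euler defect is quadratic**;
* `norm_sub_apply_zero_le`: `‖u(x,y) − u(x,0)‖ ≤ M₁ t`;
* for `(T, N)` as above: `D T(x,0)(v,0) = v`, `D N(x,0)(v,0) = 0` (`fderiv_tangential_inl`,
  `fderiv_normal_inl`), a uniform lower bound `m‖w‖ ≤ ‖D_yN(x,0) w‖` on a compact set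
  (`exists_fibre_derivative_lower_bound`), quantitative fibre injectivity
  `(m/2)‖w‖ ≤ ‖D_yN(x,y) w‖` (`fibre_derivative_lower_bound`), the lower bound
  `(m/2) t ≤ ‖N‖` (`norm_normal_ge`), the source-form Euler defect `(m/2)‖u‖ ≤ 2L t²` for the
  solution of `D_yN u = D_yN·y − N` (`norm_source_defect_le`), the kernel slope
  `(m/2)‖w‖ ≤ L t ‖v‖` (`kernel_slope_le`), and the tangential data `‖T − x‖ ≤ M₁ t`,
  `‖D_xT − I‖ ≤ L t`, `‖D_yT‖ ≤ M₁`.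

All constants depend only on the model on the compact set; everything is proved; no
definitions; no named facts.

## References

* J. R. Munkres, *Obstructions to the smoothing of piecewise-differentiable homeomorphisms*, Ann.
  of Math. (2) 72 (1960), 521–554, §§4–5. [Munkres1960]
* D. Campbell, L. D'Onofrio, T. Vítek, *Diffeomorphic approximation of piecewise affine
  homeomorphisms*, J. Geom. Anal. 36 (2026), §3. [CampbellDonofrioVitek2026]
-/

noncomputable section

open Set Function Metric Filter
open scoped Topology ContDiff

namespace Literature.Topology.FourManifolds

/-! ### §1 Uniform second-order estimates in the fibre variable -/

section Calculus

variable {E : Type*} [NormedAddCommGroup E] [NormedSpace ℝ E]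
variable {F : Type*} [NormedAddCommGroup F] [NormedSpace ℝ F]
variable {G : Type*} [NormedAddCommGroup G] [NormedSpace ℝ G]
variable {u : E × F → G} {K : Set E} {r₀ : ℝ}

/-- `∞ ≠ 0` (bookkeeping). [folklore] -/
private theorem fr_infty_ne_zero : (∞ : WithTop ℕ∞) ≠ 0 := by
  simp

omit [NormedSpace ℝ E] [NormedSpace ℝ F] in
/-- The product of a compact parameter set with a closed fibre ball is compact. [folklore] -/
theorem isCompact_prod_closedBall [ProperSpace F] (hK : IsCompact K) (r₀ : ℝ) :
    IsCompact (K ×ˢ closedBall (0 : F) r₀) :=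
  hK.prod (isCompact_closedBall 0 r₀)

/-- **A uniform bound for the derivative** of a smooth map on `K × B̄(0, r₀)`. [folklore] -/
theorem exists_norm_fderiv_le [ProperSpace F] (hu : ContDiff ℝ ∞ u) (hK : IsCompact K) (r₀ : ℝ) :
    ∃ M₁ : ℝ, 0 ≤ M₁ ∧ ∀ x ∈ K, ∀ y ∈ closedBall (0 : F) r₀, ‖fderiv ℝ u (x, y)‖ ≤ M₁ := by
  obtain ⟨M, hM⟩ := (isCompact_prod_closedBall hK r₀).exists_bound_of_continuousOn
    ((hu.continuous_fderiv fr_infty_ne_zero).continuousOn)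
  refine ⟨max M 0, le_max_right _ _, fun x hx y hy => ?_⟩
  exact (hM (x, y) ⟨hx, hy⟩).trans (le_max_left _ _)

/-- **The derivative is uniformly Lipschitz in the fibre variable** on `K × B̄(0, r₀)`:
`‖Du(x, y) − Du(x, y')‖ ≤ L ‖y − y'‖` (mean value inequality for the `C¹` map `Du` on the convex
ball). [folklore] -/
theorem exists_fderiv_lipschitz_snd [ProperSpace F] (hu : ContDiff ℝ ∞ u) (hK : IsCompact K) (r₀ : ℝ) :
    ∃ L : ℝ, 0 ≤ L ∧ ∀ x ∈ K, ∀ y ∈ closedBall (0 : F) r₀, ∀ y' ∈ closedBall (0 : F) r₀,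
      ‖fderiv ℝ u (x, y) - fderiv ℝ u (x, y')‖ ≤ L * ‖y - y'‖ := by
  have hu2 : ContDiff ℝ ∞ (fderiv ℝ u) := (contDiff_infty_iff_fderiv.1 hu).2
  obtain ⟨M, hM⟩ := (isCompact_prod_closedBall hK r₀).exists_bound_of_continuousOn
    ((hu2.continuous_fderiv fr_infty_ne_zero).continuousOn)
  refine ⟨max M 0, le_max_right _ _, fun x hx y hy y' hy' => ?_⟩
  -- the slice `g z = Du (x, z)` has derivative `D(Du)(x, z) ∘ inr`, of norm `≤ M`
  set g : F → (E × F →L[ℝ] G) := fun z => fderiv ℝ u (x, z) with hg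
  have hgd : ∀ z, HasFDerivAt g ((fderiv ℝ (fderiv ℝ u) (x, z)).comp (ContinuousLinearMap.inr ℝ E F)) z := by
    intro z
    have h1 : HasFDerivAt (fun z : F => ((x, z) : E × F)) (ContinuousLinearMap.inr ℝ E F) z :=
      hasFDerivAt_prodMk_right x z
    exact ((hu2.differentiable fr_infty_ne_zero) (x, z)).hasFDerivAt.comp z h1
  have hbound : ∀ z ∈ closedBall (0 : F) r₀, ‖fderiv ℝ g z‖ ≤ max M 0 := by
    intro z hz
    rw [(hgd z).fderiv]
    calc ‖(fderiv ℝ (fderiv ℝ u) (x, z)).comp (ContinuousLinearMap.inr ℝ E F)‖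
        ≤ ‖fderiv ℝ (fderiv ℝ u) (x, z)‖ * ‖ContinuousLinearMap.inr ℝ E F‖ :=
          ContinuousLinearMap.opNorm_comp_le _ _
      _ ≤ ‖fderiv ℝ (fderiv ℝ u) (x, z)‖ * 1 :=
          mul_le_mul_of_nonneg_left (ContinuousLinearMap.norm_inr_le_one ℝ E F)
            (norm_nonneg (fderiv ℝ (fderiv ℝ u) (x, z)))
      _ ≤ max M 0 := by rw [mul_one]; exact (hM (x, z) ⟨hx, hz⟩).trans (le_max_left _ _)
  have := (convex_closedBall (0 : F) r₀).norm_image_sub_le_of_norm_fderiv_le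
    (fun z _ => (hgd z).differentiableAt) hbound hy' hy
  exact this

/-- **The value is Lipschitz in the fibre variable**: `‖u(x, y) − u(x, 0)‖ ≤ M₁ ‖y‖` with the
uniform derivative bound `M₁`. [folklore] -/
theorem norm_sub_apply_zero_le (hu : ContDiff ℝ ∞ u) {M₁ : ℝ}
    (hM : ∀ x ∈ K, ∀ y ∈ closedBall (0 : F) r₀, ‖fderiv ℝ u (x, y)‖ ≤ M₁) {x : E} (hx : x ∈ K)
    {y : F} (hy : y ∈ closedBall (0 : F) r₀) (hr₀ : 0 ≤ r₀) : ‖u (x, y) - u (x, 0)‖ ≤ M₁ * ‖y‖ := by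
  set g : F → G := fun z => u (x, z) with hg
  have hgd : ∀ z, HasFDerivAt g ((fderiv ℝ u (x, z)).comp (ContinuousLinearMap.inr ℝ E F)) z := fun z =>
    ((hu.differentiable fr_infty_ne_zero) (x, z)).hasFDerivAt.comp z (hasFDerivAt_prodMk_right x z)
  have hbound : ∀ z ∈ closedBall (0 : F) r₀, ‖fderiv ℝ g z‖ ≤ M₁ := by
    intro z hz
    rw [(hgd z).fderiv]
    calc ‖(fderiv ℝ u (x, z)).comp (ContinuousLinearMap.inr ℝ E F)‖
        ≤ ‖fderiv ℝ u (x, z)‖ * ‖ContinuousLinearMap.inr ℝ E F‖ := ContinuousLinearMap.opNorm_comp_le _ _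
      _ ≤ ‖fderiv ℝ u (x, z)‖ * 1 :=
          mul_le_mul_of_nonneg_left (ContinuousLinearMap.norm_inr_le_one ℝ E F) (norm_nonneg _)
      _ ≤ M₁ := by rw [mul_one]; exact hM x hx z hz
  have h := (convex_closedBall (0 : F) r₀).norm_image_sub_le_of_norm_fderiv_le
    (fun z _ => (hgd z).differentiableAt) hbound (mem_closedBall_self hr₀) hy
  rw [sub_zero] at h
  exact h

/-- **Second-order Taylor estimate in the fibre variable**:
`‖u(x, y) − u(x, 0) − Du(x, 0)(0, y)‖ ≤ L ‖y‖²`. [folklore] -/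
theorem norm_taylor_snd_le (hu : ContDiff ℝ ∞ u) {L : ℝ} (hL0 : 0 ≤ L)
    (hL : ∀ x ∈ K, ∀ y ∈ closedBall (0 : F) r₀, ∀ y' ∈ closedBall (0 : F) r₀,
      ‖fderiv ℝ u (x, y) - fderiv ℝ u (x, y')‖ ≤ L * ‖y - y'‖)
    {x : E} (hx : x ∈ K) {y : F} (hy : y ∈ closedBall (0 : F) r₀) :
    ‖u (x, y) - u (x, 0) - fderiv ℝ u (x, 0) (0, y)‖ ≤ L * ‖y‖ ^ 2 := by
  have hr : ‖y‖ ≤ r₀ := mem_closedBall_zero_iff.1 hy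
  -- work on the smaller ball of radius `‖y‖`
  set g : F → G := fun z => u (x, z) with hg
  set φ : F →L[ℝ] G := (fderiv ℝ u (x, 0)).comp (ContinuousLinearMap.inr ℝ E F) with hφ
  have hgd : ∀ z, HasFDerivAt g ((fderiv ℝ u (x, z)).comp (ContinuousLinearMap.inr ℝ E F)) z := fun z =>
    ((hu.differentiable fr_infty_ne_zero) (x, z)).hasFDerivAt.comp z (hasFDerivAt_prodMk_right x z)
  have hbound : ∀ z ∈ closedBall (0 : F) ‖y‖, ‖fderiv ℝ g z - φ‖ ≤ L * ‖y‖ := by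
    intro z hz
    have hz' : z ∈ closedBall (0 : F) r₀ := closedBall_subset_closedBall hr hz
    rw [(hgd z).fderiv, hφ, ← ContinuousLinearMap.sub_comp]
    calc ‖(fderiv ℝ u (x, z) - fderiv ℝ u (x, 0)).comp (ContinuousLinearMap.inr ℝ E F)‖
        ≤ ‖fderiv ℝ u (x, z) - fderiv ℝ u (x, 0)‖ * ‖ContinuousLinearMap.inr ℝ E F‖ :=
          ContinuousLinearMap.opNorm_comp_le _ _
      _ ≤ ‖fderiv ℝ u (x, z) - fderiv ℝ u (x, 0)‖ * 1 :=
          mul_le_mul_of_nonneg_left (ContinuousLinearMap.norm_inr_le_one ℝ E F) (norm_nonneg _)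
      _ ≤ L * ‖z - 0‖ := by
          rw [mul_one]
          exact hL x hx z hz' 0 (mem_closedBall_self ((norm_nonneg y).trans hr))
      _ ≤ L * ‖y‖ := by
          rw [sub_zero]; exact mul_le_mul_of_nonneg_left (mem_closedBall_zero_iff.1 hz) hL0
  have h := (convex_closedBall (0 : F) ‖y‖).norm_image_sub_le_of_norm_fderiv_le'
    (fun z _ => (hgd z).differentiableAt) hbound (mem_closedBall_self (norm_nonneg y))
    (mem_closedBall_zero_iff.2 le_rfl)
  simp only [sub_zero] at h
  have hφy : φ y = fderiv ℝ u (x, 0) (0, y) := rfl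
  rw [hφy] at h
  calc ‖u (x, y) - u (x, 0) - fderiv ℝ u (x, 0) (0, y)‖ ≤ L * ‖y‖ * ‖y‖ := h
    _ = L * ‖y‖ ^ 2 := by ring

/-- **The Euler defect is quadratic**: `‖Du(x, y)(0, y) − (u(x, y) − u(x, 0))‖ ≤ 2L ‖y‖²`.
[folklore] -/
theorem norm_euler_defect_snd_le (hu : ContDiff ℝ ∞ u) {L : ℝ} (hL0 : 0 ≤ L)
    (hL : ∀ x ∈ K, ∀ y ∈ closedBall (0 : F) r₀, ∀ y' ∈ closedBall (0 : F) r₀,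
      ‖fderiv ℝ u (x, y) - fderiv ℝ u (x, y')‖ ≤ L * ‖y - y'‖)
    {x : E} (hx : x ∈ K) {y : F} (hy : y ∈ closedBall (0 : F) r₀) (hr₀ : 0 ≤ r₀) :
    ‖fderiv ℝ u (x, y) (0, y) - (u (x, y) - u (x, 0))‖ ≤ 2 * L * ‖y‖ ^ 2 := by
  have h1 := norm_taylor_snd_le hu hL0 hL hx hy
  have h2 : ‖fderiv ℝ u (x, y) (0, y) - fderiv ℝ u (x, 0) (0, y)‖ ≤ L * ‖y‖ ^ 2 := by
    have h := hL x hx y hy 0 (mem_closedBall_self hr₀)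
    rw [sub_zero] at h
    calc ‖fderiv ℝ u (x, y) (0, y) - fderiv ℝ u (x, 0) (0, y)‖
        = ‖(fderiv ℝ u (x, y) - fderiv ℝ u (x, 0)) (0, y)‖ := rfl
      _ ≤ ‖fderiv ℝ u (x, y) - fderiv ℝ u (x, 0)‖ * ‖((0 : E), y)‖ := ContinuousLinearMap.le_opNorm _ _
      _ ≤ L * ‖y‖ * ‖y‖ := by
          apply mul_le_mul h _ (norm_nonneg _) (mul_nonneg hL0 (norm_nonneg _))
          simp [Prod.norm_def]
      _ = L * ‖y‖ ^ 2 := by ring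
  calc ‖fderiv ℝ u (x, y) (0, y) - (u (x, y) - u (x, 0))‖
      = ‖(fderiv ℝ u (x, y) (0, y) - fderiv ℝ u (x, 0) (0, y)) -
          (u (x, y) - u (x, 0) - fderiv ℝ u (x, 0) (0, y))‖ := by abel_nf
    _ ≤ ‖fderiv ℝ u (x, y) (0, y) - fderiv ℝ u (x, 0) (0, y)‖ +
          ‖u (x, y) - u (x, 0) - fderiv ℝ u (x, 0) (0, y)‖ := norm_sub_le _ _
    _ ≤ L * ‖y‖ ^ 2 + L * ‖y‖ ^ 2 := add_le_add h2 h1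
    _ = 2 * L * ‖y‖ ^ 2 := by ring

/-- **Parameter derivatives drift linearly in the fibre variable**:
`‖Du(x, y)(v, 0) − Du(x, 0)(v, 0)‖ ≤ L ‖y‖ ‖v‖`. [folklore] -/
theorem norm_fderiv_inl_sub_le {L : ℝ} (hL0 : 0 ≤ L)
    (hL : ∀ x ∈ K, ∀ y ∈ closedBall (0 : F) r₀, ∀ y' ∈ closedBall (0 : F) r₀,
      ‖fderiv ℝ u (x, y) - fderiv ℝ u (x, y')‖ ≤ L * ‖y - y'‖)
    {x : E} (hx : x ∈ K) {y : F} (hy : y ∈ closedBall (0 : F) r₀) (hr₀ : 0 ≤ r₀) (v : E) :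
    ‖fderiv ℝ u (x, y) (v, 0) - fderiv ℝ u (x, 0) (v, 0)‖ ≤ L * ‖y‖ * ‖v‖ := by
  have h := hL x hx y hy 0 (mem_closedBall_self hr₀)
  rw [sub_zero] at h
  calc ‖fderiv ℝ u (x, y) (v, 0) - fderiv ℝ u (x, 0) (v, 0)‖
      = ‖(fderiv ℝ u (x, y) - fderiv ℝ u (x, 0)) (v, 0)‖ := rfl
    _ ≤ ‖fderiv ℝ u (x, y) - fderiv ℝ u (x, 0)‖ * ‖((v, (0 : F)) : E × F)‖ := ContinuousLinearMap.le_opNorm _ _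
    _ ≤ L * ‖y‖ * ‖v‖ := by
        apply mul_le_mul h _ (norm_nonneg _) (mul_nonneg hL0 (norm_nonneg _))
        simp [Prod.norm_def]

/-- **Fibre derivatives drift linearly in the fibre variable**:
`‖Du(x, y)(0, w) − Du(x, 0)(0, w)‖ ≤ L ‖y‖ ‖w‖`. [folklore] -/
theorem norm_fderiv_inr_sub_le {L : ℝ} (hL0 : 0 ≤ L)
    (hL : ∀ x ∈ K, ∀ y ∈ closedBall (0 : F) r₀, ∀ y' ∈ closedBall (0 : F) r₀,
      ‖fderiv ℝ u (x, y) - fderiv ℝ u (x, y')‖ ≤ L * ‖y - y'‖)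
    {x : E} (hx : x ∈ K) {y : F} (hy : y ∈ closedBall (0 : F) r₀) (hr₀ : 0 ≤ r₀) (w : F) :
    ‖fderiv ℝ u (x, y) (0, w) - fderiv ℝ u (x, 0) (0, w)‖ ≤ L * ‖y‖ * ‖w‖ := by
  have h := hL x hx y hy 0 (mem_closedBall_self hr₀)
  rw [sub_zero] at h
  calc ‖fderiv ℝ u (x, y) (0, w) - fderiv ℝ u (x, 0) (0, w)‖
      = ‖(fderiv ℝ u (x, y) - fderiv ℝ u (x, 0)) (0, w)‖ := rfl
    _ ≤ ‖fderiv ℝ u (x, y) - fderiv ℝ u (x, 0)‖ * ‖(((0 : E), w) : E × F)‖ := ContinuousLinearMap.le_opNorm _ _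
    _ ≤ L * ‖y‖ * ‖w‖ := by
        apply mul_le_mul h _ (norm_nonneg _) (mul_nonneg hL0 (norm_nonneg _))
        simp [Prod.norm_def]

end Calculus

/-! ### §2 The adapted model `(T, N)`: `T (x, 0) = x`, `N (x, 0) = 0`, `D_yN(x, 0)` invertible -/

section Model

variable {E : Type*} [NormedAddCommGroup E] [NormedSpace ℝ E]
variable {F : Type*} [NormedAddCommGroup F] [NormedSpace ℝ F]
variable {T : E × F → E} {N : E × F → F} {V K : Set E} {r₀ : ℝ}

/-- `∞ ≠ 0` (bookkeeping). [folklore] -/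
private theorem model_infty_ne_zero : (∞ : WithTop ℕ∞) ≠ 0 := by
  simp

/-- **Along the simplex the tangential part is the identity to first order**: if `T (x, 0) = x`
on the open set `V` then `D T(x, 0)(v, 0) = v` for `x ∈ V`. [folklore] -/
theorem fderiv_inl_eq_of_apply_zero {G : Type*} [NormedAddCommGroup G] [NormedSpace ℝ G]
    {u : E × F → G} {g : E → G} (hV : IsOpen V) (hu : ContDiff ℝ ∞ u) (hg : ContDiff ℝ ∞ g)
    (h0 : ∀ x ∈ V, u (x, 0) = g x) {x : E} (hx : x ∈ V) (v : E) :
    fderiv ℝ u (x, 0) (v, 0) = fderiv ℝ g x v := by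
  -- compare the derivatives of `x' ↦ u (x', 0)` and `g` at `x`, which agree near `x`
  have h1 : HasFDerivAt (fun x' : E => u (x', 0))
      ((fderiv ℝ u (x, 0)).comp (ContinuousLinearMap.inl ℝ E F)) x :=
    ((hu.differentiable model_infty_ne_zero) (x, 0)).hasFDerivAt.comp x (hasFDerivAt_prodMk_left x (0 : F))
  have h2 : HasFDerivAt (fun x' : E => u (x', 0)) (fderiv ℝ g x) x := by
    refine ((hg.differentiable model_infty_ne_zero) x).hasFDerivAt.congr_of_eventuallyEq ?_
    filter_upwards [hV.mem_nhds hx] with x' hx'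
    exact h0 x' hx'
  have := congrArg (fun L : E →L[ℝ] G => L v) (h1.unique h2)
  exact this

/-- `D T(x, 0)(v, 0) = v` on `V` when `T (x, 0) = x` there. [folklore] -/
theorem fderiv_tangential_inl (hV : IsOpen V) (hT : ContDiff ℝ ∞ T) (hT0 : ∀ x ∈ V, T (x, 0) = x)
    {x : E} (hx : x ∈ V) (v : E) : fderiv ℝ T (x, 0) (v, 0) = v := by
  rw [fderiv_inl_eq_of_apply_zero (g := fun x : E => x) hV hT contDiff_id hT0 hx v]
  exact congrArg (fun L : E →L[ℝ] E => L v) (fderiv_id (𝕜 := ℝ) (x := x))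

/-- `D N(x, 0)(v, 0) = 0` on `V` when `N (x, 0) = 0` there. [folklore] -/
theorem fderiv_normal_inl (hV : IsOpen V) (hN : ContDiff ℝ ∞ N) (hN0 : ∀ x ∈ V, N (x, 0) = 0)
    {x : E} (hx : x ∈ V) (v : E) : fderiv ℝ N (x, 0) (v, 0) = 0 := by
  rw [fderiv_inl_eq_of_apply_zero (g := fun _ : E => (0 : F)) hV hN contDiff_const hN0 hx v]
  simp

/-- **A uniform lower bound for the fibre derivative on the simplex**: if `D_yN(x, 0)` is
injective for every `x` in the compact `K` (finite-dimensional fibre), then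
`m ‖w‖ ≤ ‖D N(x, 0)(0, w)‖` for a constant `m > 0`. [folklore] -/
theorem exists_fibre_derivative_lower_bound [FiniteDimensional ℝ F] (hN : ContDiff ℝ ∞ N)
    (hK : IsCompact K) (hinj : ∀ x ∈ K, ∀ w : F, fderiv ℝ N (x, 0) (0, w) = 0 → w = 0) :
    ∃ m : ℝ, 0 < m ∧ ∀ x ∈ K, ∀ w : F, m * ‖w‖ ≤ ‖fderiv ℝ N (x, 0) (0, w)‖ := by
  -- the continuous function `(x, w) ↦ ‖D N(x,0)(0,w)‖` on the compact `K × 𝕊`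
  set f : E × F → ℝ := fun q => ‖fderiv ℝ N (q.1, 0) (0, q.2)‖ with hf
  have hfc : Continuous f := by
    have h1 : Continuous fun q : E × F => fderiv ℝ N (q.1, 0) :=
      (hN.continuous_fderiv model_infty_ne_zero).comp (continuous_fst.prodMk continuous_const)
    have h2 : Continuous fun q : E × F => (((0 : E), q.2) : E × F) := continuous_const.prodMk continuous_snd
    exact (h1.clm_apply h2).norm
  set S : Set (E × F) := K ×ˢ sphere (0 : F) 1 with hS
  have hSc : IsCompact S := hK.prod (isCompact_sphere 0 1)
  by_cases hSne : S.Nonempty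
  · obtain ⟨q₀, hq₀, hmin⟩ := hSc.exists_isMinOn hSne hfc.continuousOn
    have hpos : 0 < f q₀ := by
      have hq2 : q₀.2 ≠ 0 := by
        have : ‖q₀.2‖ = 1 := mem_sphere_zero_iff_norm.1 hq₀.2
        intro h; rw [h, norm_zero] at this; exact one_ne_zero this.symm
      refine lt_of_le_of_ne (norm_nonneg _) (fun h => hq2 (hinj q₀.1 hq₀.1 q₀.2 ?_))
      exact norm_eq_zero.1 h.symm
    refine ⟨f q₀, hpos, fun x hx w => ?_⟩
    by_cases hw : w = 0
    · rw [hw, norm_zero, mul_zero]; exact norm_nonneg _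
    · have hwn : ‖w‖ ≠ 0 := norm_ne_zero_iff.2 hw
      have hmem : (x, ‖w‖⁻¹ • w) ∈ S :=
        ⟨hx, by rw [mem_sphere_zero_iff_norm, norm_smul, norm_inv, norm_norm, inv_mul_cancel₀ hwn]⟩
      have h1 : f q₀ ≤ f (x, ‖w‖⁻¹ • w) := hmin hmem
      have h2 : f (x, ‖w‖⁻¹ • w) = ‖w‖⁻¹ * ‖fderiv ℝ N (x, 0) (0, w)‖ := by
        simp only [hf]
        have : (((0 : E), ‖w‖⁻¹ • w) : E × F) = ‖w‖⁻¹ • ((0 : E), w) := by ext <;> simp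
        rw [this, map_smul, norm_smul, norm_inv, norm_norm]
      rw [h2] at h1
      have hwpos : 0 < ‖w‖ := norm_pos_iff.2 hw
      calc f q₀ * ‖w‖ ≤ ‖w‖⁻¹ * ‖fderiv ℝ N (x, 0) (0, w)‖ * ‖w‖ :=
            mul_le_mul_of_nonneg_right h1 hwpos.le
        _ = ‖fderiv ℝ N (x, 0) (0, w)‖ := by field_simp
  · -- `K × 𝕊` empty: either `K = ∅` or the fibre is trivial
    refine ⟨1, one_pos, fun x hx w => ?_⟩
    have hw : w = 0 := by
      by_contra hw
      have hwn : ‖w‖ ≠ 0 := norm_ne_zero_iff.2 hw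
      exact hSne ⟨(x, ‖w‖⁻¹ • w), hx, by
        rw [mem_sphere_zero_iff_norm, norm_smul, norm_inv, norm_norm, inv_mul_cancel₀ hwn]⟩
    rw [hw, norm_zero, mul_zero]; exact norm_nonneg _

/-! #### The scale-`t` estimates -/

/-- **Quantitative fibre injectivity near the simplex**: with the Lipschitz constant `L` of `DN`
in the fibre and the lower bound `m` on the simplex, `(m/2)‖w‖ ≤ ‖D N(x, y)(0, w)‖` whenever
`L ‖y‖ ≤ m/2`. [folklore] -/
theorem fibre_derivative_lower_bound {L m : ℝ} (hL0 : 0 ≤ L)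
    (hL : ∀ x ∈ K, ∀ y ∈ closedBall (0 : F) r₀, ∀ y' ∈ closedBall (0 : F) r₀,
      ‖fderiv ℝ N (x, y) - fderiv ℝ N (x, y')‖ ≤ L * ‖y - y'‖)
    (hm : ∀ x ∈ K, ∀ w : F, m * ‖w‖ ≤ ‖fderiv ℝ N (x, 0) (0, w)‖)
    {x : E} (hx : x ∈ K) {y : F} (hy : y ∈ closedBall (0 : F) r₀) (hr₀ : 0 ≤ r₀)
    (hsmall : L * ‖y‖ ≤ m / 2) (w : F) : m / 2 * ‖w‖ ≤ ‖fderiv ℝ N (x, y) (0, w)‖ := by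
  have h1 := norm_fderiv_inr_sub_le hL0 hL hx hy hr₀ w
  have h2 := hm x hx w
  have h3 : ‖fderiv ℝ N (x, 0) (0, w)‖ ≤ ‖fderiv ℝ N (x, y) (0, w)‖ +
      ‖fderiv ℝ N (x, y) (0, w) - fderiv ℝ N (x, 0) (0, w)‖ := by
    have := norm_sub_le (fderiv ℝ N (x, y) (0, w)) (fderiv ℝ N (x, y) (0, w) - fderiv ℝ N (x, 0) (0, w))
    rwa [sub_sub_cancel] at this
  nlinarith [norm_nonneg w, mul_le_mul_of_nonneg_right hsmall (norm_nonneg w)]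

/-- **Two-sided bounds for the normal part near the simplex**: `(m/2)‖y‖ ≤ ‖N(x, y)‖` for
`L‖y‖ ≤ m/2` (and `‖N(x, y)‖ ≤ M₁‖y‖` is `norm_sub_apply_zero_le`). [folklore] -/
theorem norm_normal_ge (hN : ContDiff ℝ ∞ N) (hN0 : ∀ x ∈ K, N (x, 0) = 0) {L m : ℝ} (hL0 : 0 ≤ L)
    (hL : ∀ x ∈ K, ∀ y ∈ closedBall (0 : F) r₀, ∀ y' ∈ closedBall (0 : F) r₀,
      ‖fderiv ℝ N (x, y) - fderiv ℝ N (x, y')‖ ≤ L * ‖y - y'‖)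
    (hm : ∀ x ∈ K, ∀ w : F, m * ‖w‖ ≤ ‖fderiv ℝ N (x, 0) (0, w)‖)
    {x : E} (hx : x ∈ K) {y : F} (hy : y ∈ closedBall (0 : F) r₀)
    (hsmall : L * ‖y‖ ≤ m / 2) : m / 2 * ‖y‖ ≤ ‖N (x, y)‖ := by
  have h1 := norm_taylor_snd_le hN hL0 hL hx hy
  rw [hN0 x hx, sub_zero] at h1
  have h2 := hm x hx y
  have h3 : ‖fderiv ℝ N (x, 0) (0, y)‖ ≤ ‖N (x, y)‖ + ‖N (x, y) - fderiv ℝ N (x, 0) (0, y)‖ := by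
    have := norm_sub_le (N (x, y)) (N (x, y) - fderiv ℝ N (x, 0) (0, y))
    rwa [sub_sub_cancel] at this
  have h4 : L * ‖y‖ ^ 2 ≤ m / 2 * ‖y‖ := by
    rw [pow_two, ← mul_assoc]; exact mul_le_mul_of_nonneg_right hsmall (norm_nonneg y)
  linarith

/-- **The source-form Euler defect is quadratic**: if `D N(x, y)(0, u) = D N(x, y)(0, y) − N(x, y)`
then `(m/2)‖u‖ ≤ 2L‖y‖²` (for `L‖y‖ ≤ m/2`). [folklore] -/
theorem norm_source_defect_le (hN : ContDiff ℝ ∞ N) (hN0 : ∀ x ∈ K, N (x, 0) = 0) {L m : ℝ} (hL0 : 0 ≤ L)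
    (hL : ∀ x ∈ K, ∀ y ∈ closedBall (0 : F) r₀, ∀ y' ∈ closedBall (0 : F) r₀,
      ‖fderiv ℝ N (x, y) - fderiv ℝ N (x, y')‖ ≤ L * ‖y - y'‖)
    (hm : ∀ x ∈ K, ∀ w : F, m * ‖w‖ ≤ ‖fderiv ℝ N (x, 0) (0, w)‖)
    {x : E} (hx : x ∈ K) {y : F} (hy : y ∈ closedBall (0 : F) r₀) (hr₀ : 0 ≤ r₀)
    (hsmall : L * ‖y‖ ≤ m / 2) {u : F}
    (hu : fderiv ℝ N (x, y) (0, u) = fderiv ℝ N (x, y) (0, y) - N (x, y)) :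
    m / 2 * ‖u‖ ≤ 2 * L * ‖y‖ ^ 2 := by
  have h1 := fibre_derivative_lower_bound hL0 hL hm hx hy hr₀ hsmall u
  have h2 := norm_euler_defect_snd_le hN hL0 hL hx hy hr₀
  rw [hN0 x hx, sub_zero] at h2
  rw [hu] at h1
  exact h1.trans h2

/-- **Kernel slope of `DN` near the simplex**: `D N(x, y)(v, w) = 0 ⟹ (m/2)‖w‖ ≤ L‖y‖‖v‖`, so the
kernel is a graph over `E` of slope `O(‖y‖)` (the constant `K` of the flatten coupling).
[folklore] -/
theorem kernel_slope_le (hV : IsOpen V) (hKV : K ⊆ V) (hN : ContDiff ℝ ∞ N) (hN0 : ∀ x ∈ V, N (x, 0) = 0)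
    {L m : ℝ} (hL0 : 0 ≤ L)
    (hL : ∀ x ∈ K, ∀ y ∈ closedBall (0 : F) r₀, ∀ y' ∈ closedBall (0 : F) r₀,
      ‖fderiv ℝ N (x, y) - fderiv ℝ N (x, y')‖ ≤ L * ‖y - y'‖)
    (hm : ∀ x ∈ K, ∀ w : F, m * ‖w‖ ≤ ‖fderiv ℝ N (x, 0) (0, w)‖)
    {x : E} (hx : x ∈ K) {y : F} (hy : y ∈ closedBall (0 : F) r₀) (hr₀ : 0 ≤ r₀)
    (hsmall : L * ‖y‖ ≤ m / 2) {v : E} {w : F} (h0 : fderiv ℝ N (x, y) (v, w) = 0) :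
    m / 2 * ‖w‖ ≤ L * ‖y‖ * ‖v‖ := by
  have hsplit : fderiv ℝ N (x, y) (v, w) = fderiv ℝ N (x, y) (v, 0) + fderiv ℝ N (x, y) (0, w) := by
    rw [← map_add]; congr 1; ext <;> simp
  have h1 : ‖fderiv ℝ N (x, y) (0, w)‖ = ‖fderiv ℝ N (x, y) (v, 0)‖ := by
    rw [hsplit] at h0
    rw [← norm_neg, (neg_eq_of_add_eq_zero_left h0)]
  have h2 := norm_fderiv_inl_sub_le hL0 hL hx hy hr₀ v
  rw [fderiv_normal_inl hV hN hN0 (hKV hx) v, sub_zero] at h2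
  have h3 := fibre_derivative_lower_bound hL0 hL hm hx hy hr₀ hsmall w
  linarith

/-- **Tangential data near the simplex**: `‖T(x, y) − x‖ ≤ M₁‖y‖` when `T (x, 0) = x`.
[folklore] -/
theorem norm_tangential_sub_le (hT : ContDiff ℝ ∞ T) (hT0 : ∀ x ∈ K, T (x, 0) = x) {M₁ : ℝ}
    (hM : ∀ x ∈ K, ∀ y ∈ closedBall (0 : F) r₀, ‖fderiv ℝ T (x, y)‖ ≤ M₁) {x : E} (hx : x ∈ K)
    {y : F} (hy : y ∈ closedBall (0 : F) r₀) (hr₀ : 0 ≤ r₀) : ‖T (x, y) - x‖ ≤ M₁ * ‖y‖ := by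
  have h := norm_sub_apply_zero_le hT hM hx hy hr₀
  rwa [hT0 x hx] at h

/-- `‖D T(x, y)(v, 0) − v‖ ≤ L‖y‖‖v‖` when `T (x, 0) = x` on the open `V ⊇ K`. [folklore] -/
theorem norm_fderiv_tangential_inl_sub_le (hV : IsOpen V) (hKV : K ⊆ V) (hT : ContDiff ℝ ∞ T)
    (hT0 : ∀ x ∈ V, T (x, 0) = x) {L : ℝ} (hL0 : 0 ≤ L)
    (hL : ∀ x ∈ K, ∀ y ∈ closedBall (0 : F) r₀, ∀ y' ∈ closedBall (0 : F) r₀,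
      ‖fderiv ℝ T (x, y) - fderiv ℝ T (x, y')‖ ≤ L * ‖y - y'‖)
    {x : E} (hx : x ∈ K) {y : F} (hy : y ∈ closedBall (0 : F) r₀) (hr₀ : 0 ≤ r₀) (v : E) :
    ‖fderiv ℝ T (x, y) (v, 0) - v‖ ≤ L * ‖y‖ * ‖v‖ := by
  have h := norm_fderiv_inl_sub_le hL0 hL hx hy hr₀ v
  rwa [fderiv_tangential_inl hV hT hT0 (hKV hx) v] at h

/-- `‖D T(x, y)(0, w)‖ ≤ M₁‖w‖` from the uniform derivative bound. [folklore] -/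
theorem norm_fderiv_tangential_inr_le {M₁ : ℝ}
    (hM : ∀ x ∈ K, ∀ y ∈ closedBall (0 : F) r₀, ‖fderiv ℝ T (x, y)‖ ≤ M₁) {x : E} (hx : x ∈ K)
    {y : F} (hy : y ∈ closedBall (0 : F) r₀) (w : F) : ‖fderiv ℝ T (x, y) (0, w)‖ ≤ M₁ * ‖w‖ := by
  calc ‖fderiv ℝ T (x, y) (0, w)‖ ≤ ‖fderiv ℝ T (x, y)‖ * ‖(((0 : E), w) : E × F)‖ :=
        ContinuousLinearMap.le_opNorm _ _
    _ ≤ M₁ * ‖w‖ := by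
        apply mul_le_mul (hM x hx y hy) _ (norm_nonneg _) ((norm_nonneg _).trans (hM x hx y hy))
        simp [Prod.norm_def]

end Model

end Literature.Topology.FourManifolds
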